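import Mathlib.LinearAlgebra.Matrix.Adjugate
import Literature.NumberTheory.EllipticCurves.HeckeCongruenceModulus
import HarnessLib

/-!
# Crux A `DegreePrimesPolyBounded` (stmt-ABC-2045), line `newpart_congruence_friability`:
# the determinantal (Plücker) form of Pasten's Prop. 5.4

For the bet `stub_newPartPrimesOfDatum` (congruence primes of a curve newform `f` against a new
Galois orbit `P` of the Hecke ring `𝕋 = anemicHeckeRing N 2` are `≤ C N^κ`) every landed bound is
exponential in `d = rank_ℤ 𝕋/P`.  The reason is a lattice identity: with `χ₀ = χ_f : 𝕋 → ℤ`,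
`η = #𝕋/(ker χ₀ + P) = [𝕋/P × ℤ : im 𝕋]`, so `η` divides every maximal minor of the "augmented
coordinate matrix" of ANY `d + 1` Hecke operators `x_j` — the integer matrix whose rows `some i`
are the coordinates of `x_j mod P` in a `ℤ`-basis `b` of `𝕋/P` and whose row `none` is `χ₀(x_j)`,
written inline below as ``Matrix.of fun (i j : Option ι) ↦ i.elim (χ₀ (x j)) fun i ↦ b.repr (x_j mod P) i``
(no definition is introduced: proof-only file).  Theorem `congruenceModulus_dvd_det_augmented`;
the single-operator case is Prop. 5.4 itself (`congruenceModulus_dvd_of_mem`).  The cofactors of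
the row `none` are an explicit integer relation `∑ c_j x_j ∈ P` (Laplace expansion of a determinant
with a repeated row, `sum_adjugate_smul_mem`), so the theorem IS Prop. 5.4 applied to the Plücker
relations of the orbit.  Size (for the record; lead c18, `Cruxes/…/CENSUS-c18-heckeorder.md`): over
`ℂ` the same determinant equals `det[ρ_i(x_j); χ₀(x_j)] / det[ρ_i(b_k)]` with
`|det[ρ_i(b_k)]|² = |disc(𝕋/P)|`, whence `η · |disc 𝕋/P|^{1/2} ≤ (d+1)! ∏_j H(x_j)`: the
exponential loss of the known regimes is exactly the deficiency of the discriminant of the Hecke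
order `𝕋/P` against the Hadamard bound of `d + 1` short Hecke operators.
-/

-- `Summit.<Summit>.<Problem>` is the mandated summit-side namespace (CONVENTIONS §2); for the
-- single-conjunct summit `ABC` the two coincide, so the duplicate `ABC.ABC` is deliberate.
set_option linter.dupNamespace false

noncomputable section

open scoped MatrixGroups ModularForm
open CongruenceSubgroup Matrix

namespace Summit.ABC.ABC.Theorems.DegreePrimesPolyBounded

open Literature.NumberTheory.EllipticCurves.ModularForms

/-! ### Abstract form: any commutative ring `R`, `χ₀ : R → ℤ`, ideal `P` with `R ⧸ P` free -/

section Abstract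

variable {R : Type*} [CommRing R] {ι : Type*} [Fintype ι] [DecidableEq ι]

/-- Cofactors along a row do not see that row. [folklore] -/
theorem adjugate_updateRow_self {n : Type*} [Fintype n] [DecidableEq n] {α : Type*} [CommRing α]
    (A : Matrix n n α) (i : n) (v : n → α) (j : n) :
    (A.updateRow i v).adjugate j i = A.adjugate j i := by
  rw [adjugate_apply, adjugate_apply, updateRow_idem]

/-- **The Plücker relation of `d + 1` elements of a free rank-`d` quotient.**  With `c_j` the
cofactors of the augmented coordinate matrix along the row `none`, `∑_j c_j x_j ∈ P`: every
`b`-coordinate of its class is the determinant of a matrix with two equal rows. [folklore] -/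
theorem sum_adjugate_smul_mem (χ₀ : R →+* ℤ) (P : Ideal R) (b : Module.Basis ι ℤ (R ⧸ P))
    (x : Option ι → R) :
    ∑ j, (Matrix.of fun (i j : Option ι) ↦ i.elim (χ₀ (x j)) fun i ↦ b.repr (Ideal.Quotient.mk P (x j)) i
      ).adjugate j none • x j ∈ P := by
  set M : Matrix (Option ι) (Option ι) ℤ :=
    Matrix.of fun (i j : Option ι) ↦ i.elim (χ₀ (x j)) fun i ↦ b.repr (Ideal.Quotient.mk P (x j)) i with hM
  rw [← Ideal.Quotient.eq_zero_iff_mem, map_sum]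
  simp_rw [map_zsmul]
  apply b.repr.injective
  rw [map_sum, map_zero]
  ext i
  simp_rw [Finsupp.coe_finsetSum, Finset.sum_apply, map_zsmul, Finsupp.smul_apply, smul_eq_mul]
  -- the matrix with row `none` replaced by row `some i` has two equal rows
  have hdet : (M.updateRow none (M (some i))).det = 0 :=
    det_zero_of_row_eq (i := some i) (j := none) (Option.some_ne_none i)
      (by rw [updateRow_self, updateRow_ne (Option.some_ne_none i)])
  rw [det_eq_sum_mul_adjugate_row _ none] at hdet
  simp_rw [updateRow_self, adjugate_updateRow_self] at hdet
  rw [Finsupp.coe_zero, Pi.zero_apply, ← hdet]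
  refine Finset.sum_congr rfl fun j _ ↦ ?_
  rw [hM, Matrix.of_apply, Option.elim_some, mul_comm]

/-- **Determinantal form of Pasten's Prop. 5.4 (abstract).**  For a ring map `χ₀ : R → ℤ`, an
ideal `P` with `R ⧸ P` free over `ℤ` with basis `b`, and ANY family `x` of `rank + 1` elements of
`R`, the congruence modulus `η = #R/(ker χ₀ + P)` divides the determinant of the augmented
coordinate matrix `[b-coords of x_j mod P ; χ₀(x_j)]`.  (Expanding along the row `none`,
`det = χ₀(∑ c_j x_j)` with `∑ c_j x_j ∈ P` by `sum_adjugate_smul_mem`, and `η ∣ χ₀(t)` for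
`t ∈ P`.) [folklore] -/
theorem congruenceModulus_dvd_det_augmented (χ₀ : R →+* ℤ) (P : Ideal R)
    (b : Module.Basis ι ℤ (R ⧸ P)) (x : Option ι → R) :
    (congruenceModulus (RingHom.ker χ₀) P : ℤ) ∣
      (Matrix.of fun (i j : Option ι) ↦ i.elim (χ₀ (x j)) fun i ↦ b.repr (Ideal.Quotient.mk P (x j)) i).det := by
  have h := congruenceModulus_dvd_of_mem χ₀ (sum_adjugate_smul_mem χ₀ P b x)
  rw [map_sum] at h
  simp_rw [map_zsmul, smul_eq_mul] at h
  rw [det_eq_sum_mul_adjugate_row _ none]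
  simp_rw [Matrix.of_apply, Option.elim_none]
  convert h using 2 with j
  ring

/-- Consequently `η ≤ |det|` whenever the augmented determinant is nonzero, i.e. whenever the
`x_j` are independent modulo `P ∩ ker χ₀`. [folklore] -/
theorem congruenceModulus_le_natAbs_det_augmented (χ₀ : R →+* ℤ) (P : Ideal R)
    (b : Module.Basis ι ℤ (R ⧸ P)) (x : Option ι → R)
    (hx : (Matrix.of fun (i j : Option ι) ↦ i.elim (χ₀ (x j)) fun i ↦ b.repr (Ideal.Quotient.mk P (x j)) i
      ).det ≠ 0) :
    congruenceModulus (RingHom.ker χ₀) P ≤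
      (Matrix.of fun (i j : Option ι) ↦ i.elim (χ₀ (x j)) fun i ↦ b.repr (Ideal.Quotient.mk P (x j)) i
        ).det.natAbs :=
  Nat.le_of_dvd (Int.natAbs_pos.mpr hx)
    (by simpa using Int.natAbs_dvd_natAbs.mpr (congruenceModulus_dvd_det_augmented χ₀ P b x))

end Abstract

/-! ### The Hecke ring: `η_f(P)` divides every augmented Plücker determinant -/

variable {N : ℕ} [NeZero N] {k : ℤ}

/-- **`η_{[χ_f]}(P)` divides the augmented determinant of any `d + 1` Hecke operators**
(`d = rank_ℤ 𝕋/P`): for `f ≠ 0` with integral eigenvalues `χ_f`, an ideal `P` of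
`𝕋 = anemicHeckeRing N k` with `𝕋 ⧸ P` free (e.g. a minimal prime), a `ℤ`-basis `b` of `𝕋 ⧸ P`
and Hecke operators `x_j` (`j : Option ι`), `heckeCongruenceModulus f P` divides
`det[b-coords(x_j mod P); χ_f(x_j)]`.  The single-operator case is Pasten's Prop. 5.4
(`heckeCongruenceModulus_dvd_of_mem`). [cite: PastenShimura2024, Prop. 5.4 p. 17] -/
theorem heckeCongruenceModulus_dvd_det_augmented {f : CuspForm (Gamma0 N) k}
    (hf : HasIntegralEigenvalues f) (hf0 : f ≠ 0) (P : Ideal (anemicHeckeRing N k))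
    {ι : Type*} [Fintype ι] [DecidableEq ι] (b : Module.Basis ι ℤ (anemicHeckeRing N k ⧸ P))
    (x : Option ι → anemicHeckeRing N k) :
    (heckeCongruenceModulus f P : ℤ) ∣
      (Matrix.of fun (i j : Option ι) ↦ i.elim (intEigencharacter hf hf0 (x j))
        fun i ↦ b.repr (Ideal.Quotient.mk P (x j)) i).det := by
  rw [heckeCongruenceModulus, eigenIdeal_eq_ker_intEigencharacter hf hf0]
  exact congruenceModulus_dvd_det_augmented _ P b x

/-- **… hence `η_{[χ_f]}(P) ≤ |det|` whenever that determinant is nonzero** (i.e. whenever the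
`x_j` are linearly independent modulo `P ∩ 𝕀_f`). [cite: PastenShimura2024, Prop. 5.4 p. 17] -/
theorem heckeCongruenceModulus_le_natAbs_det_augmented {f : CuspForm (Gamma0 N) k}
    (hf : HasIntegralEigenvalues f) (hf0 : f ≠ 0) (P : Ideal (anemicHeckeRing N k))
    {ι : Type*} [Fintype ι] [DecidableEq ι] (b : Module.Basis ι ℤ (anemicHeckeRing N k ⧸ P))
    (x : Option ι → anemicHeckeRing N k)
    (hx : (Matrix.of fun (i j : Option ι) ↦ i.elim (intEigencharacter hf hf0 (x j))
      fun i ↦ b.repr (Ideal.Quotient.mk P (x j)) i).det ≠ 0) :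
    heckeCongruenceModulus f P ≤
      (Matrix.of fun (i j : Option ι) ↦ i.elim (intEigencharacter hf hf0 (x j))
        fun i ↦ b.repr (Ideal.Quotient.mk P (x j)) i).det.natAbs := by
  rw [heckeCongruenceModulus, eigenIdeal_eq_ker_intEigencharacter hf hf0]
  exact congruenceModulus_le_natAbs_det_augmented _ P b x hx

/-- **Registered sub-goal `stub_augmentedDeterminantDivisibility` of crux stmt-ABC-2045** (line
`newpart_congruence_friability`, lead c18): `η_{[χ_f]}(P)` divides the augmented determinant of any
`d + 1` Hecke operators with respect to a `ℤ`-basis `b : Fin d → 𝕋 ⧸ P` — the determinantal form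
of Pasten's Prop. 5.4 (`heckeCongruenceModulus_dvd_det_augmented`).
[cite: PastenShimura2024, Prop. 5.4 p. 17] -/
theorem stub_augmentedDeterminantDivisibility :
    ∀ (N : ℕ) [NeZero N] (k : ℤ) (f : CuspForm (Gamma0 N) k) (hf : HasIntegralEigenvalues f)
    (hf0 : f ≠ 0) (P : Ideal (anemicHeckeRing N k)) (d : ℕ)
    (b : Module.Basis (Fin d) ℤ (anemicHeckeRing N k ⧸ P)) (x : Option (Fin d) → anemicHeckeRing N k),
    (heckeCongruenceModulus f P : ℤ) ∣ (Matrix.of fun (i j : Option (Fin d)) ↦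
      i.elim (intEigencharacter hf hf0 (x j)) fun i ↦ b.repr (Ideal.Quotient.mk P (x j)) i).det :=
  fun _ _ _ _ hf hf0 P _ b x ↦ heckeCongruenceModulus_dvd_det_augmented hf hf0 P b x

end Summit.ABC.ABC.Theorems.DegreePrimesPolyBounded

end
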